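import Summits.CriticalPhenomena.SAWScalingLimit.Theorems.SAWDevelopingMapObservableToSLETypeLadderCarvedReductionSqueezeLimitCover
import Summits.CriticalPhenomena.SAWScalingLimit.Theorems.SAWDevelopingMapObservableToSLETypeLadderCarvedReductionSqueezeCorridor
import Summits.CriticalPhenomena.SAWScalingLimit.Theorems.SAWDevelopingMapObservableToSLETypeLadderCarvedReductionSqueezeBulk
import Summits.CriticalPhenomena.SAWScalingLimit.Theorems.SAWDevelopingMapObservableToSLETypeLadderCarvedReductionSqueezeUniformizer
import HarnessLib

/-!
# Geometry of the swallowed zones (piece (T-A′₂F zone geometry) of stub T-A′₂F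
# `stub_carvedReduction_squeezeGeometry_domainsCoreF`)

Crux `SAWDevelopingMap.ObservableToSLE` (stmt-CriticalPhenomena-10472), line `six-class-type-ladder`,
stub T-A′₂F `stub_carvedReduction_squeezeGeometry_domainsCoreF`.  Landing target:
`Summits/CriticalPhenomena/SAWScalingLimit/Theorems/SAWDevelopingMapObservableToSLETypeLadderCarvedReductionSqueezeZoneGeom.lean`.

The confined outer sequence (`outerSeq`) swallows, at stage `n`, the zone `Z_n` — the
persistently removed structure of the limit carving shrunk by `s = 4ε_n`, inside the companion
zone `Z'_n` shrunk by `2ε_n`.  This file fixes the ELEMENTARY GEOMETRY of the zones: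

* the pieces of the zone of one side at shrink `s`: the open shrunken skew hexagons
  `hexInt C ϱ s = {∀ ℓ, |skewCoord ℓ (z - C)| < ϱ - 2s}` (cells and fat connectors), the lower
  half-window `lowerWin P ρ s = {im < im P - s} ∩ ball P (ρ/2 - s)`, the open cores
  `coreZone K m s = {infDist · K < m - s}` of the spine (`m = ρ/8`) and of the body (`m = ρ/4`);
  their union `sideZone`; openness, the THICKENING rule "`z' ∈ zone[s']`, `dist z z' < s' - s`
  ⇒ `z ∈ zone[s]`" (`sideZone_of_dist_lt`), and connectedness of `sideZone` from the link
  hypotheses "every nonempty shrunken cell meets its connector or the spine core, every nonempty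
  shrunken connector meets the spine core" (`isConnected_sideZone`);
* the collar `collarZone K z∞ c`: the component of a far point `z∞` in `{c < infDist · K}`
  (`K = closure (D - τ)`): open, antitone in `c`, `c/2`-separated from the outside of
  `collarZone K z∞ (c/2)`, exhausting `Kᶜ` when `Kᶜ` is connected, uniformly on compacts
  (`exists_subset_collarZone_of_isCompact`), and `(closedBall 0 r)ᶜ` is connected.
Registered carrier: `stub_carvedReduction_zoneGeom`.
-/

noncomputable section

open scoped Topology
open Filter Set Metric Bornology
open Literature.Probability.RandomPlanarGeometry

namespace Summit.CriticalPhenomena.SAWScalingLimit.Theorems.ObservableToSLE.TypeLadder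

open Summit.CriticalPhenomena.SAWScalingLimit.Theorems.ObservableToSLER.BridgeGate

/-! ### The pieces of a side zone -/

/-- The open skew hexagon about `C` of radius `ϱ` shrunk by `s` (Euclidean margin `≥ s` inside
the closed hexagon `{∀ ℓ, |skewCoord ℓ (z - C)| ≤ ϱ}`, as `skewCoord` is `2`-Lipschitz). -/
def hexInt (C : ℂ) (ϱ s : ℝ) : Set ℂ := {z : ℂ | ∀ ℓ : Fin 3, |skewCoord ℓ (z - C)| < ϱ - 2 * s}

/-- The open lower half-window below the gate `P` (window radius `ρ/2`) shrunk by `s`. -/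
def lowerWin (P : ℂ) (ρ s : ℝ) : Set ℂ := {z : ℂ | z.im < P.im - s} ∩ ball P (ρ / 2 - s)

/-- The open core `{infDist · K < m - s}` of a set `K` (radius `m`) shrunk by `s`. -/
def coreZone (K : Set ℂ) (m s : ℝ) : Set ℂ := {z : ℂ | infDist z K < m - s}

/-- **The zone of one side at shrink `s`**: lower half-window, spine core (`ρ/8`), body core
(`ρ/4`), shrunken cells and shrunken connectors. -/
def sideZone {N : ℕ} (P : ℂ) (ρ : ℝ) (Ksp B : Set ℂ) (cell conn : Fin N → ℂ × ℝ) (s : ℝ) : Set ℂ :=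
  (lowerWin P ρ s ∪ coreZone Ksp (ρ / 8) s ∪ coreZone B (ρ / 4) s) ∪
    ⋃ a, (hexInt (cell a).1 (cell a).2 s ∪ hexInt (conn a).1 (conn a).2 s)

section Pieces

variable {N : ℕ} {P : ℂ} {ρ : ℝ} {Ksp B : Set ℂ} {cell conn : Fin N → ℂ × ℝ}

/-- The shrunken hexagon is open. -/
theorem isOpen_hexInt (C : ℂ) (ϱ s : ℝ) : IsOpen (hexInt C ϱ s) := by
  have h : hexInt C ϱ s = ⋂ ℓ : Fin 3, {z : ℂ | |skewCoord ℓ (z - C)| < ϱ - 2 * s} := by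
    ext z; simp [hexInt]
  rw [h]
  exact isOpen_iInter_of_finite fun ℓ =>
    isOpen_lt (continuous_abs.comp ((continuous_skewCoord ℓ).comp (continuous_id.sub continuous_const)))
      continuous_const

/-- The lower half-window is open. -/
theorem isOpen_lowerWin (P : ℂ) (ρ s : ℝ) : IsOpen (lowerWin P ρ s) :=
  (isOpen_lt Complex.continuous_im continuous_const).inter isOpen_ball

/-- The core is open. -/
theorem isOpen_coreZone (K : Set ℂ) (m s : ℝ) : IsOpen (coreZone K m s) :=
  isOpen_lt (continuous_infDist_pt K) continuous_const

/-- The side zone is open. -/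
theorem isOpen_sideZone (s : ℝ) : IsOpen (sideZone P ρ Ksp B cell conn s) :=
  (((isOpen_lowerWin P ρ s).union (isOpen_coreZone _ _ _)).union (isOpen_coreZone _ _ _)).union
    (isOpen_iUnion fun _ => (isOpen_hexInt _ _ _).union (isOpen_hexInt _ _ _))

/-- THICKENING RULE for hexagons: a point within `s' - s` of the `s'`-shrunken hexagon lies in the
`s`-shrunken one. -/
theorem hexInt_of_dist_lt {C : ℂ} {ϱ s s' : ℝ} {z z' : ℂ} (hz' : z' ∈ hexInt C ϱ s') (hd : dist z z' < s' - s) :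
    z ∈ hexInt C ϱ s := fun ℓ => by
  have h1 := abs_skewCoord_sub_le_add ℓ z z' C
  have h2 := hz' ℓ
  rw [dist_comm] at hd
  linarith

/-- THICKENING RULE for the lower half-window. -/
theorem lowerWin_of_dist_lt {s s' : ℝ} {z z' : ℂ} (hz' : z' ∈ lowerWin P ρ s') (hd : dist z z' < s' - s) :
    z ∈ lowerWin P ρ s := by
  obtain ⟨h1, h2⟩ := hz'
  rw [mem_ball] at h2
  have him : |(z - z').im| ≤ dist z z' := by rw [dist_eq_norm]; exact Complex.abs_im_le_norm _
  rw [Complex.sub_im, abs_le] at him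
  refine ⟨?_, ?_⟩
  · show z.im < P.im - s
    have : z'.im < P.im - s' := h1
    linarith
  · rw [mem_ball]
    linarith [dist_triangle z z' P]

/-- THICKENING RULE for cores. -/
theorem coreZone_of_dist_lt {K : Set ℂ} {m s s' : ℝ} {z z' : ℂ} (hz' : z' ∈ coreZone K m s') (hd : dist z z' < s' - s) :
    z ∈ coreZone K m s := by
  have h1 : infDist z' K < m - s' := hz'
  show infDist z K < m - s
  linarith [infDist_le_infDist_add_dist (x := z) (y := z') (s := K)]

/-- **THICKENING RULE for the side zone**: a point within `s' - s` of the `s'`-zone lies in the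
`s`-zone. -/
theorem sideZone_of_dist_lt {s s' : ℝ} {z z' : ℂ} (hz' : z' ∈ sideZone P ρ Ksp B cell conn s')
    (hd : dist z z' < s' - s) : z ∈ sideZone P ρ Ksp B cell conn s := by
  rcases hz' with ((h | h) | h) | h
  · exact Or.inl (Or.inl (Or.inl (lowerWin_of_dist_lt h hd)))
  · exact Or.inl (Or.inl (Or.inr (coreZone_of_dist_lt h hd)))
  · exact Or.inl (Or.inr (coreZone_of_dist_lt h hd))
  · rw [mem_iUnion] at h
    obtain ⟨a, ha⟩ := h
    refine Or.inr (mem_iUnion.2 ⟨a, ?_⟩)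
    rcases ha with ha | ha
    · exact Or.inl (hexInt_of_dist_lt ha hd)
    · exact Or.inr (hexInt_of_dist_lt ha hd)

/-- The side zones decrease in the shrink parameter. -/
theorem sideZone_mono {s s' : ℝ} (h : s < s') : sideZone P ρ Ksp B cell conn s' ⊆ sideZone P ρ Ksp B cell conn s :=
  fun z hz => sideZone_of_dist_lt hz (by rw [dist_self]; linarith)

/-- **Margin from closure**: a point of the closure of the `s'`-zone within `s' - s` of `w` puts `w`
in the `s`-zone. -/
theorem mem_sideZone_of_mem_closure {s s' : ℝ} {z w : ℂ} (hz : z ∈ closure (sideZone P ρ Ksp B cell conn s'))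
    (hd : dist w z < s' - s) : w ∈ sideZone P ρ Ksp B cell conn s := by
  obtain ⟨z', hz', hzz'⟩ := Metric.mem_closure_iff.1 hz ((s' - s - dist w z) / 2) (by linarith)
  refine sideZone_of_dist_lt (s := s) (s' := s') hz' ?_
  linarith [dist_triangle w z z']

/-- The shrunken hexagon is convex. -/
theorem convex_hexInt (C : ℂ) (ϱ s : ℝ) : Convex ℝ (hexInt C ϱ s) := by
  intro z hz w hw a b ha hb hab ℓ
  have e : a • z + b • w - C = ((a : ℝ) : ℂ) * (z - C) + ((b : ℝ) : ℂ) * (w - C) := by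
    rw [Complex.real_smul, Complex.real_smul]
    have : (C : ℂ) = ((a : ℝ) : ℂ) * C + ((b : ℝ) : ℂ) * C := by
      rw [← add_mul, ← Complex.ofReal_add, hab, Complex.ofReal_one, one_mul]
    conv_lhs => rw [this]
    ring
  rw [e, skewCoord_add, skewCoord_real_mul, skewCoord_real_mul]
  refine (abs_add_le _ _).trans_lt ?_
  rw [abs_mul, abs_mul, abs_of_nonneg ha, abs_of_nonneg hb]
  rcases ha.lt_or_eq with ha' | rfl
  · calc a * |skewCoord ℓ (z - C)| + b * |skewCoord ℓ (w - C)| < a * (ϱ - 2 * s) + b * (ϱ - 2 * s) :=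
          add_lt_add_of_lt_of_le (mul_lt_mul_of_pos_left (hz ℓ) ha') (mul_le_mul_of_nonneg_left (hw ℓ).le hb)
      _ = ϱ - 2 * s := by rw [← add_mul, hab, one_mul]
  · rw [zero_add] at hab
    subst hab
    simpa using hw ℓ

/-- The lower half-window is convex. -/
theorem convex_lowerWin (P : ℂ) (ρ s : ℝ) : Convex ℝ (lowerWin P ρ s) :=
  (convex_halfSpace_im_lt _).inter (convex_ball _ _)

/-- The centre lies in the shrunken hexagon as soon as it is nonempty (`2s < ϱ`). -/
theorem center_mem_hexInt {C : ℂ} {ϱ s : ℝ} (h : 2 * s < ϱ) : C ∈ hexInt C ϱ s := fun ℓ => by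
  have : skewCoord ℓ (C - C) = 0 := by
    rw [sub_self]; fin_cases ℓ <;> simp [skewCoord]
  rw [this, abs_zero]; linarith

/-- Radial retraction into the shrunken hexagon: for `z` in the closed hexagon and `t ≤ 1`,
`C + (1 - t)(z - C)` lies in `hexInt C ϱ s` as soon as `2s < tϱ`. -/
theorem retract_mem_hexInt {C z : ℂ} {ϱ s t : ℝ} (hz : ∀ ℓ : Fin 3, |skewCoord ℓ (z - C)| ≤ ϱ)
    (ht1 : t ≤ 1) (hs : 2 * s < t * ϱ) :
    C + (((1 - t : ℝ)) : ℂ) * (z - C) ∈ hexInt C ϱ s := fun ℓ => by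
  have hϱ : 0 ≤ ϱ := le_trans (abs_nonneg _) (hz 0)
  rw [add_sub_cancel_left, skewCoord_real_mul, abs_mul, abs_of_nonneg (by linarith)]
  calc (1 - t) * |skewCoord ℓ (z - C)| ≤ (1 - t) * ϱ := mul_le_mul_of_nonneg_left (hz ℓ) (by linarith)
    _ < ϱ - 2 * s := by nlinarith

/-! ### Connectedness of a side zone -/

/-- **The side zone is connected** when the body `B ∋ P - (ρ/2) i` and the spine `Ksp` are connected
and meet, `s < ρ/16`, and the LINKS hold: every nonempty shrunken cell meets its shrunken
connector or the spine core, every nonempty shrunken connector meets the spine core. -/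
theorem isConnected_sideZone {s : ℝ} (hρ : 0 < ρ) (hs : s < ρ / 16) (hB : IsConnected B)
    (hK : IsConnected Ksp) (hPB : P - ((ρ / 2 : ℝ) : ℂ) * Complex.I ∈ B) (hBK : (B ∩ Ksp).Nonempty)
    (hlink1 : ∀ a, (hexInt (cell a).1 (cell a).2 s).Nonempty →
      (hexInt (cell a).1 (cell a).2 s ∩ (hexInt (conn a).1 (conn a).2 s ∪ coreZone Ksp (ρ / 8) s)).Nonempty)
    (hlink2 : ∀ a, (hexInt (conn a).1 (conn a).2 s).Nonempty →
      (hexInt (conn a).1 (conn a).2 s ∩ coreZone Ksp (ρ / 8) s).Nonempty) :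
    IsConnected (sideZone P ρ Ksp B cell conn s) := by
  -- the trunk
  set z₀ : ℂ := P - ((3 * ρ / 8 : ℝ) : ℂ) * Complex.I with hz₀
  have hz₀L : z₀ ∈ lowerWin P ρ s := by
    refine ⟨?_, ?_⟩
    · show z₀.im < P.im - s
      rw [hz₀]; simp; linarith
    · rw [mem_ball, hz₀, dist_eq_norm, sub_sub_cancel_left, norm_neg, norm_mul, Complex.norm_real, Complex.norm_I,
        mul_one, Real.norm_eq_abs, abs_of_pos (by positivity)]
      linarith
  have hz₀B : z₀ ∈ coreZone B (ρ / 4) s := by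
    show infDist z₀ B < ρ / 4 - s
    refine (infDist_le_dist_of_mem hPB).trans_lt ?_
    rw [hz₀, dist_eq_norm]
    have : P - ((3 * ρ / 8 : ℝ) : ℂ) * Complex.I - (P - ((ρ / 2 : ℝ) : ℂ) * Complex.I) = ((ρ / 8 : ℝ) : ℂ) * Complex.I := by
      push_cast; ring
    rw [this, norm_mul, Complex.norm_real, Complex.norm_I, mul_one, Real.norm_eq_abs, abs_of_pos (by positivity)]
    linarith
  obtain ⟨α, hαB, hαK⟩ := hBK
  have hαBc : α ∈ coreZone B (ρ / 4) s := by
    show infDist α B < ρ / 4 - s; rw [infDist_zero_of_mem hαB]; linarith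
  have hαKc : α ∈ coreZone Ksp (ρ / 8) s := by
    show infDist α Ksp < ρ / 8 - s; rw [infDist_zero_of_mem hαK]; linarith
  have hLc : IsPreconnected (lowerWin P ρ s) := (convex_lowerWin P ρ s).isPreconnected
  have hBc : IsPreconnected (coreZone B (ρ / 4) s) := (isConnected_infDistZone hB (by linarith)).isPreconnected
  have hKc : IsPreconnected (coreZone Ksp (ρ / 8) s) := (isConnected_infDistZone hK (by linarith)).isPreconnected
  set T : Set ℂ := lowerWin P ρ s ∪ coreZone Ksp (ρ / 8) s ∪ coreZone B (ρ / 4) s with hTdef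
  have hT : IsPreconnected T := by
    have h1 : IsPreconnected (lowerWin P ρ s ∪ coreZone B (ρ / 4) s) := hLc.union z₀ hz₀L hz₀B hBc
    have h2 : IsPreconnected ((lowerWin P ρ s ∪ coreZone B (ρ / 4) s) ∪ coreZone Ksp (ρ / 8) s) :=
      h1.union α (Or.inr hαBc) hαKc hKc
    have : T = (lowerWin P ρ s ∪ coreZone B (ρ / 4) s) ∪ coreZone Ksp (ρ / 8) s := by
      rw [hTdef]; ac_rfl
    rwa [this]
  have hKT : coreZone Ksp (ρ / 8) s ⊆ T := fun z hz => Or.inl (Or.inr hz)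
  have hTZ : T ⊆ sideZone P ρ Ksp B cell conn s := fun z hz => Or.inl hz
  -- each hexagon piece hangs on the trunk
  have hconnT : ∀ a, (hexInt (conn a).1 (conn a).2 s).Nonempty → IsPreconnected (T ∪ hexInt (conn a).1 (conn a).2 s) :=
    fun a hne => by
      obtain ⟨y, hy1, hy2⟩ := hlink2 a hne
      exact hT.union y (hKT hy2) hy1 (convex_hexInt _ _ _).isPreconnected
  refine ⟨⟨z₀, hTZ (Or.inl (Or.inl hz₀L))⟩, isPreconnected_of_forall z₀ fun y hy => ?_⟩
  rcases hy with hy | hy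
  · exact ⟨T, hTZ, Or.inl (Or.inl hz₀L), hy, hT⟩
  · rw [mem_iUnion] at hy
    obtain ⟨a, hy⟩ := hy
    have hconnZ : hexInt (conn a).1 (conn a).2 s ⊆ sideZone P ρ Ksp B cell conn s := fun z hz =>
      Or.inr (mem_iUnion.2 ⟨a, Or.inr hz⟩)
    have hcellZ : hexInt (cell a).1 (cell a).2 s ⊆ sideZone P ρ Ksp B cell conn s := fun z hz =>
      Or.inr (mem_iUnion.2 ⟨a, Or.inl hz⟩)
    rcases hy with hy | hy
    · obtain ⟨w, hw1, hw2⟩ := hlink1 a ⟨y, hy⟩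
      rcases hw2 with hw2 | hw2
      · refine ⟨(T ∪ hexInt (conn a).1 (conn a).2 s) ∪ hexInt (cell a).1 (cell a).2 s,
          union_subset (union_subset hTZ hconnZ) hcellZ, Or.inl (Or.inl (Or.inl (Or.inl hz₀L))), Or.inr hy, ?_⟩
        exact (hconnT a ⟨w, hw2⟩).union w (Or.inr hw2) hw1 (convex_hexInt _ _ _).isPreconnected
      · refine ⟨T ∪ hexInt (cell a).1 (cell a).2 s, union_subset hTZ hcellZ, Or.inl (Or.inl (Or.inl hz₀L)), Or.inr hy, ?_⟩
        exact hT.union w (hKT hw2) hw1 (convex_hexInt _ _ _).isPreconnected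
    · exact ⟨T ∪ hexInt (conn a).1 (conn a).2 s, union_subset hTZ hconnZ, Or.inl (Or.inl (Or.inl hz₀L)), Or.inr hy,
        hconnT a ⟨y, hy⟩⟩

end Pieces

/-! ### The collar -/

/-- **The collar** at distance `c` from `K` (`K = closure (D - τ)`): the connected component of the
far point `z∞` in `{z | c < infDist z K}`. -/
def collarZone (K : Set ℂ) (zf : ℂ) (c : ℝ) : Set ℂ := connectedComponentIn {z : ℂ | c < infDist z K} zf

section Collar

variable {K : Set ℂ} {zf : ℂ}

/-- The collar is open. -/
theorem isOpen_collarZone (c : ℝ) : IsOpen (collarZone K zf c) :=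
  (isOpen_lt continuous_const (continuous_infDist_pt K)).connectedComponentIn

/-- The collar is preconnected. -/
theorem isPreconnected_collarZone (c : ℝ) : IsPreconnected (collarZone K zf c) :=
  isPreconnected_connectedComponentIn

/-- The collars increase as `c` decreases. -/
theorem collarZone_mono {c c' : ℝ} (h : c' ≤ c) : collarZone K zf c ⊆ collarZone K zf c' :=
  connectedComponentIn_mono _ fun z (hz : c < infDist z K) => lt_of_le_of_lt h hz

/-- Points of the collar are `c`-far from `K`; points of its closure are at least `c`-far. -/
theorem le_infDist_of_mem_closure_collarZone {c : ℝ} {z : ℂ} (hz : z ∈ closure (collarZone K zf c)) :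
    c ≤ infDist z K := by
  have h1 : closure (collarZone K zf c) ⊆ {z : ℂ | c ≤ infDist z K} :=
    closure_minimal (fun w hw => (show c < infDist w K from connectedComponentIn_subset {z : ℂ | c < infDist z K} zf hw).le)
      (isClosed_le continuous_const (continuous_infDist_pt K))
  exact h1 hz

/-- **The `c/2`-margin of the collar**: a point within `c/2` of the `c`-collar lies in the
`c/2`-collar. -/
theorem mem_collarZone_half_of_dist_lt {c : ℝ} {a b : ℂ} (ha : a ∈ collarZone K zf c) (hab : dist a b < c / 2) :
    b ∈ collarZone K zf (c / 2) := by
  have ha2 : a ∈ collarZone K zf (c / 2) := collarZone_mono (by linarith [dist_nonneg (x := a) (y := b)]) ha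
  have hseg : segment ℝ a b ⊆ {z : ℂ | c / 2 < infDist z K} := by
    intro w hw
    have hwa : dist w a < c / 2 := by
      have := (convex_ball a (c / 2)).segment_subset (mem_ball_self (by linarith [dist_nonneg (x := a) (y := b)]))
        (mem_ball.2 (by rw [dist_comm]; exact hab)) hw
      exact mem_ball.1 this
    have hac : c < infDist a K := connectedComponentIn_subset {z : ℂ | c < infDist z K} zf ha
    show c / 2 < infDist w K
    have := infDist_le_infDist_add_dist (x := a) (y := w) (s := K)
    rw [dist_comm] at hwa
    linarith
  have hj : JoinedIn {z : ℂ | c / 2 < infDist z K} a b := JoinedIn.of_segment_subset hseg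
  rw [collarZone, connectedComponentIn_eq ha2]
  exact mem_bulk_of_joinedIn hj

/-- **Exhaustion**: when `K` is compact nonempty with connected complement, every point off `K`
lies in some collar (`z∞ ∉ K`). -/
theorem exists_mem_collarZone (hK : IsCompact K) (hKne : K.Nonempty) (hKc : IsPreconnected Kᶜ) (hzf : zf ∉ K)
    {z : ℂ} (hz : z ∉ K) : ∃ c > (0 : ℝ), z ∈ collarZone K zf c := by
  have hKo : IsOpen Kᶜ := hK.isClosed.isOpen_compl
  have hpc : IsPathConnected Kᶜ := hKo.isConnected_iff_isPathConnected.1 ⟨⟨z, hz⟩, hKc⟩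
  obtain ⟨γ, hγ⟩ := hpc.joinedIn zf hzf z hz
  have hRc : IsCompact (range γ) := isCompact_range γ.continuous
  have hdisj : Disjoint (range γ) K := by
    rw [disjoint_left]; rintro _ ⟨t, rfl⟩ h; exact hγ t h
  obtain ⟨r, hr, hfar⟩ := exists_pos_forall_le_infDist hRc hK.isClosed hKne hdisj
  refine ⟨r / 2, half_pos hr, ?_⟩
  have hsub : range γ ⊆ {w : ℂ | r / 2 < infDist w K} := fun w hw => by
    show r / 2 < infDist w K; linarith [hfar w hw]
  have hpre : IsPreconnected (range γ) := (isPreconnected_range γ.continuous)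
  exact hpre.subset_connectedComponentIn ⟨0, γ.source⟩ hsub ⟨1, γ.target⟩

/-- **Uniform exhaustion on compacts**: a compact set off `K` lies in a single collar. -/
theorem exists_subset_collarZone_of_isCompact (hK : IsCompact K) (hKne : K.Nonempty) (hKc : IsPreconnected Kᶜ)
    (hzf : zf ∉ K) {T : Set ℂ} (hT : IsCompact T) (hTK : Disjoint T K) :
    ∃ c > (0 : ℝ), T ⊆ collarZone K zf c := by
  set U : ℕ → Set ℂ := fun k => collarZone K zf (1 / ((k : ℝ) + 1)) with hU
  have hcover : T ⊆ ⋃ k, U k := by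
    intro p hp
    obtain ⟨c, hc, hpc⟩ := exists_mem_collarZone hK hKne hKc hzf (disjoint_left.1 hTK hp)
    obtain ⟨k, hk⟩ := exists_nat_one_div_lt hc
    exact mem_iUnion.2 ⟨k, collarZone_mono hk.le hpc⟩
  obtain ⟨t, ht⟩ := hT.elim_finite_subcover U (fun k => isOpen_collarZone _) hcover
  refine ⟨1 / (((t.sup id : ℕ) : ℝ) + 1), by positivity, fun p hp => ?_⟩
  obtain ⟨k, hk, hpk⟩ := mem_iUnion₂.1 (ht hp)
  refine collarZone_mono ?_ hpk
  have hk' : (k : ℝ) ≤ ((t.sup id : ℕ) : ℝ) := by exact_mod_cast Finset.le_sup (f := id) hk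
  exact one_div_le_one_div_of_le (by positivity) (by linarith)

/-- Far points lie in the collar: if `{w | R < ‖w‖} ⊆ Kᶜ`-far... precisely, a preconnected set
`S ∋ z∞` on which `infDist · K > c` lies in the `c`-collar. -/
theorem subset_collarZone_of_isPreconnected {c : ℝ} {S : Set ℂ} (hS : IsPreconnected S) (hzf : zf ∈ S)
    (hfar : ∀ z ∈ S, c < infDist z K) : S ⊆ collarZone K zf c :=
  hS.subset_connectedComponentIn hzf hfar

end Collar

/-- **The complement of a closed ball in `ℂ` is connected** (image of `sphere 0 1 × (r, ∞)`). -/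
theorem isConnected_compl_closedBall_zero {r : ℝ} (hr : 0 ≤ r) : IsConnected (closedBall (0 : ℂ) r)ᶜ := by
  have hrank : 1 < Module.rank ℝ ℂ := by rw [Complex.rank_real_complex]; norm_num
  have hS : IsConnected (sphere (0 : ℂ) 1) := isConnected_sphere hrank 0 zero_le_one
  have hprod : IsConnected (sphere (0 : ℂ) 1 ×ˢ Ioi r) := hS.prod (isConnected_Ioi)
  have himage : (fun p : ℂ × ℝ => ((p.2 : ℝ) : ℂ) * p.1) '' (sphere (0 : ℂ) 1 ×ˢ Ioi r) = (closedBall (0 : ℂ) r)ᶜ := by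
    ext z
    simp only [mem_image, mem_prod, mem_sphere_iff_norm, sub_zero, mem_Ioi, mem_compl_iff, mem_closedBall,
      dist_zero_right, not_le, Prod.exists]
    constructor
    · rintro ⟨u, t, ⟨hu, ht⟩, rfl⟩
      rw [norm_mul, Complex.norm_real, hu, mul_one, Real.norm_eq_abs, abs_of_pos (hr.trans_lt ht)]
      exact ht
    · intro hz
      have hz0 : z ≠ 0 := fun h => by rw [h, norm_zero] at hz; linarith
      have hnz : (‖z‖ : ℂ) ≠ 0 := by exact_mod_cast (norm_ne_zero_iff.2 hz0)
      refine ⟨(‖z‖ : ℂ)⁻¹ * z, ‖z‖, ⟨?_, hz⟩, ?_⟩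
      · rw [norm_mul, norm_inv, Complex.norm_real, Real.norm_eq_abs, abs_of_nonneg (norm_nonneg _),
          inv_mul_cancel₀ (norm_ne_zero_iff.2 hz0)]
      · rw [← mul_assoc, mul_inv_cancel₀ hnz, one_mul]
  rw [← himage]
  exact hprod.image _ (by fun_prop)

/-- **Registered carrier `stub_carvedReduction_zoneGeom`** (crux item stmt-CriticalPhenomena-10472,
stub T-A′₂F `stub_carvedReduction_squeezeGeometry_domainsCoreF`, piece ZONE GEOMETRY): the complement
of a closed ball about `0` in `ℂ` is connected. -/
theorem stub_carvedReduction_zoneGeom : ∀ r : ℝ, 0 ≤ r → IsConnected (closedBall (0 : ℂ) r)ᶜ :=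
  fun _ hr => isConnected_compl_closedBall_zero hr

end Summit.CriticalPhenomena.SAWScalingLimit.Theorems.ObservableToSLE.TypeLadder

end
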